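import Summits.RiemannHypothesis.RiemannHypothesis.Theses.SmoothSectorHardy
import Summits.RiemannHypothesis.RiemannHypothesis.Theorems.ScrewLemmaKCoprofileCalculus
import Summits.RiemannHypothesis.RiemannHypothesis.Theorems.SmoothSectorHardyDefs
import Summits.RiemannHypothesis.RiemannHypothesis.Theorems.SmoothSectorHardyMellinStrip
import Summits.RiemannHypothesis.RiemannHypothesis.Theorems.SmoothSectorHardyProfileMuentz
import HarnessLib

/-!
# Route `SmoothSectorHardy`, item `ProfileMellinFormula` (K1a, stmt-RiemannHypothesis-22982 —
# the rev-1 restatement of retired stmt-RiemannHypothesis-21565)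

For every admissible generator `g` and every real `t`: IF the Mellin integral of the profile
function `H = 1_{(0,1)}(h − h₀) − h₀·1_{[1,∞)}` converges absolutely at `w₀ = −1/2 + it`, THEN

  `𝓜H(w₀) = ζ(w₀)/w₀ · (−∫₀¹ g′(u) u^{w₀} du)`.

Proof (Müntz's formula continued one strip to the left, Titchmarsh 1986 §2.11, for `C¹` data under
the absolute-convergence hypothesis only):
1. `Re w > 0`, `w ≠ 1`: `𝓜h(w) = ζ(w)∫₀¹ g u^{w−1}` (strip Müntz with `∫g = 0`, tree) and
   `∫₀¹ g u^{w−1} = −(1/w)∫₀¹ g′u^w` (IBP, `g(1) = 0`), while `𝓜h(w) = P(w) + h₀/w` with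
   `P = 𝓜Ψ`, `Ψ = 1_{(0,1)}(h − h₀)`; hence `F₁(w) := w·P(w) + h₀ = −ζ(w)·G(w) =: F₂(w)` there,
   `G(w) = ∫₀¹ g′u^w`.
2. The hypothesis gives `MellinConvergent Ψ` at the real abscissa `−1/2`; Müntz gives it at `2`;
   so `P` is holomorphic on `−1/2 < Re w < 2` and continuous on the closed strip
   (`differentiableAt_mellin_strip`, `continuousOn_mellin_strip`).  `G` is holomorphic on `Re w > −1`
   and `ζ` away from `1`, so `F₁ = F₂` on the convex strip `−1/2 < Re w < 1` by the identity theorem,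
   and at `w₀` (on its boundary) by continuity within the strip.
3. `𝓜H(w₀) = P(w₀) + h₀/w₀ = F₁(w₀)/w₀ = −ζ(w₀)G(w₀)/w₀`.
RH-free; nothing here bears on the truth of RH.

Main result: `profileMellinFormula_proof : …Theses.SmoothSectorHardy.ProfileMellinFormula`.
-/

set_option linter.dupNamespace false

noncomputable section

namespace Summit.RiemannHypothesis.RiemannHypothesis.Theorems.SmoothSectorHardy

open MeasureTheory Set Filter Complex Topology
open Summit.RiemannHypothesis.RiemannHypothesis.Theorems.IntegerScrew (latticeProfile
  latticePlateau SmoothSectorAdmissible)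
open Summit.RiemannHypothesis.RiemannHypothesis.Theorems.ScrewLemmaKCoprofile
  (exists_bound_deriv_Ioo)

/-! ## The generator transform `G(w) = ∫₀¹ g′(u) u^w du` is holomorphic on `Re w > −1` -/

/-- The Mellin transform of the datum `1_{(0,1]}·g′` converges absolutely at every real `σ > 0`
when `g′` is bounded on `(0,1)`. [folklore] -/
theorem mellinConvergent_indicator_deriv {g : ℝ → ℝ} {B : ℝ}
    (hB : ∀ u ∈ Ioo (0:ℝ) 1, |deriv g u| ≤ B) {σ : ℝ} (hσ : 0 < σ) :
    MellinConvergent ((Ioc (0:ℝ) 1).indicator (fun u => ((deriv g u : ℝ) : ℂ))) (σ : ℂ) := by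
  unfold MellinConvergent
  rw [← Ioc_union_Ioi_eq_Ioi zero_le_one, integrableOn_union]
  constructor
  · rw [integrableOn_Ioc_iff_integrableOn_Ioo]
    have hdom : IntegrableOn (fun u : ℝ => B * u ^ (σ - 1)) (Ioo 0 1) := by
      have h := (intervalIntegral.intervalIntegrable_rpow' (a := 0) (b := 1) (r := σ - 1)
        (by linarith))
      rw [intervalIntegrable_iff_integrableOn_Ioo_of_le zero_le_one] at h
      exact h.const_mul B
    refine hdom.mono' ?_ ?_
    · have h1 : AEStronglyMeasurable (fun u : ℝ => (u : ℂ) ^ ((σ : ℂ) - 1))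
          (volume.restrict (Ioo (0:ℝ) 1)) := by
        refine ContinuousOn.aestronglyMeasurable (fun u hu => ?_) measurableSet_Ioo
        exact (Complex.continuousAt_ofReal_cpow_const u ((σ : ℂ) - 1)
          (Or.inr hu.1.ne')).continuousWithinAt
      exact h1.smul ((Complex.measurable_ofReal.comp (measurable_deriv g)).indicator
        measurableSet_Ioc).aestronglyMeasurable
    · refine (ae_restrict_mem measurableSet_Ioo).mono fun u hu => ?_
      rw [norm_smul, Complex.norm_cpow_eq_rpow_re_of_pos hu.1, indicator_of_mem
        (Ioo_subset_Ioc_self hu), Complex.norm_real, Real.norm_eq_abs]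
      simp only [Complex.sub_re, Complex.ofReal_re, Complex.one_re]
      rw [mul_comm]
      exact mul_le_mul_of_nonneg_right (hB u hu) (Real.rpow_nonneg hu.1.le _)
  · refine (integrableOn_congr_fun (fun u hu => ?_) measurableSet_Ioi).mpr integrableOn_zero
    have h1 : u ∉ Ioc (0:ℝ) 1 := fun h => (not_lt.mpr h.2) hu
    simp [indicator_of_notMem h1]

/-- `G(w) = ∫₀¹ g′(u)u^w du` is the Mellin transform of `1_{(0,1]}·g′` at `w + 1`. [folklore] -/
theorem integral_deriv_mul_cpow_eq_mellin (g : ℝ → ℝ) (w : ℂ) :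
    ∫ u in Ioo (0:ℝ) 1, ((deriv g u : ℝ) : ℂ) * (u : ℂ) ^ w
      = mellin ((Ioc (0:ℝ) 1).indicator (fun u => ((deriv g u : ℝ) : ℂ))) (w + 1) := by
  rw [mellin_indicator_ofReal (deriv g) (w + 1), add_sub_cancel_right]

/-- The generator transform is holomorphic on `Re w > −1` for `g` of class `C¹` on `[0,1]`.
[folklore] -/
theorem differentiableAt_generatorTransform {g : ℝ → ℝ} (hg : ContDiffOn ℝ 1 g (Icc 0 1))
    {w : ℂ} (hw : -1 < w.re) :
    DifferentiableAt ℂ (fun w : ℂ => ∫ u in Ioo (0:ℝ) 1, ((deriv g u : ℝ) : ℂ) * (u : ℂ) ^ w) w := by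
  obtain ⟨B, hB⟩ := exists_bound_deriv_Ioo hg
  have e : (fun w : ℂ => ∫ u in Ioo (0:ℝ) 1, ((deriv g u : ℝ) : ℂ) * (u : ℂ) ^ w)
      = fun w => mellin ((Ioc (0:ℝ) 1).indicator (fun u => ((deriv g u : ℝ) : ℂ))) (w + 1) :=
    funext (integral_deriv_mul_cpow_eq_mellin g)
  rw [e]
  have hmeas : AEStronglyMeasurable ((Ioc (0:ℝ) 1).indicator (fun u => ((deriv g u : ℝ) : ℂ)))
      (volume.restrict (Ioi 0)) :=
    ((Complex.measurable_ofReal.comp (measurable_deriv g)).indicator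
      measurableSet_Ioc).aestronglyMeasurable
  have hσ₁ : 0 < (w.re + 1) / 2 := by linarith
  have hd : DifferentiableAt ℂ
      (mellin ((Ioc (0:ℝ) 1).indicator (fun u => ((deriv g u : ℝ) : ℂ)))) (w + 1) :=
    differentiableAt_mellin_strip hmeas (mellinConvergent_indicator_deriv hB hσ₁)
      (mellinConvergent_indicator_deriv hB (by linarith : 0 < w.re + 2))
      (by simp only [Complex.add_re, Complex.one_re]; linarith)
      (by simp only [Complex.add_re, Complex.one_re]; linarith)
  have hcomp : DifferentiableAt ℂ (fun w : ℂ => w + 1) w := differentiableAt_id.add_const 1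
  show DifferentiableAt ℂ
    ((mellin ((Ioc (0:ℝ) 1).indicator (fun u => ((deriv g u : ℝ) : ℂ)))) ∘ (fun w : ℂ => w + 1)) w
  exact hd.comp w hcomp

/-! ## The closer -/

/-- **Item `ProfileMellinFormula` (K1a, stmt-RiemannHypothesis-22982 = rev 1 of 21565)**, the route decl by
name: for admissible `g`, real `t` and `w₀ = −1/2 + it`, absolute convergence of `𝓜H(w₀)` implies
`𝓜H(w₀) = ζ(w₀)/w₀ · (−∫₀¹ g′(u)u^{w₀} du)` — Müntz's formula (2.11.1) continued to `Re w = −1/2`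
by the identity theorem and boundary continuity. RH-free. [cite: Titchmarsh1986, §2.11 (2.11.1)] -/
theorem profileMellinFormula_proof :
    Summit.RiemannHypothesis.RiemannHypothesis.Theses.SmoothSectorHardy.ProfileMellinFormula := by
  unfold Summit.RiemannHypothesis.RiemannHypothesis.Theses.SmoothSectorHardy.ProfileMellinFormula
  intro g hg t hMC
  change MellinConvergent (profileFun g) (-(1 / 2 : ℂ) + t * Complex.I) at hMC
  show mellin (profileFun g) (-(1 / 2 : ℂ) + t * Complex.I) = _
  set w₀ : ℂ := -(1 / 2 : ℂ) + t * Complex.I with hw₀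
  have hw₀re : w₀.re = -(1 / 2) := by simp [hw₀]
  have hw₀ne : w₀ ≠ 0 := fun h => by
    have := congrArg Complex.re h
    rw [hw₀re, Complex.zero_re] at this
    norm_num at this
  set h₀ : ℂ := ((latticePlateau g : ℝ) : ℂ) with hh₀
  -- Step 3b: `𝓜H(w₀) = P(w₀) + h₀/w₀`, and `Ψ` converges absolutely at `w₀`
  obtain ⟨hΨw₀, hHΨ⟩ := mellin_profileFun_eq_profileDev_add (g := g) (by rw [hw₀re]; norm_num) hMC
  -- measurability of `Ψ` on `(0,∞)` (from the integrability at `w₀`)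
  have hΨmeas : AEStronglyMeasurable (profileDev g) (volume.restrict (Ioi 0)) := by
    have h1 : AEStronglyMeasurable
        (fun y : ℝ => (y : ℂ) ^ (1 - w₀) • ((y : ℂ) ^ (w₀ - 1) • profileDev g y))
        (volume.restrict (Ioi 0)) := by
      have hc : AEStronglyMeasurable (fun y : ℝ => (y : ℂ) ^ (1 - w₀))
          (volume.restrict (Ioi 0)) := by
        refine ContinuousOn.aestronglyMeasurable (fun y hy => ?_) measurableSet_Ioi
        exact (Complex.continuousAt_ofReal_cpow_const y (1 - w₀)
          (Or.inr (ne_of_gt hy))).continuousWithinAt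
      exact hc.smul hΨw₀.aestronglyMeasurable
    refine h1.congr ((ae_restrict_mem measurableSet_Ioi).mono fun y hy => ?_)
    have hy' : (y : ℂ) ≠ 0 := Complex.ofReal_ne_zero.mpr (ne_of_gt hy)
    simp only
    rw [smul_smul, ← Complex.cpow_add _ _ hy', show (1 - w₀) + (w₀ - 1) = 0 by ring,
      Complex.cpow_zero, one_smul]
  -- `Ψ` at the real abscissae `−1/2` and `2`
  have hΨσ₁ : MellinConvergent (profileDev g) (((-(1 / 2) : ℝ)) : ℂ) := by
    refine (hΨw₀.norm).mono' (aestronglyMeasurable_cpow_smul hΨmeas _) ?_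
    refine (ae_restrict_mem measurableSet_Ioi).mono fun y hy => ?_
    rw [norm_smul, norm_smul, Complex.norm_cpow_eq_rpow_re_of_pos hy,
      Complex.norm_cpow_eq_rpow_re_of_pos hy]
    simp [hw₀re]
  have hΨσ₂ : MellinConvergent (profileDev g) ((2 : ℝ) : ℂ) := by
    have h := (mellin_latticeProfile_eq_profileDev_add hg (w := (2 : ℂ)) (by norm_num)
      (by norm_num)).1
    exact_mod_cast h
  -- the two functions
  set P : ℂ → ℂ := mellin (profileDev g) with hP
  set Gt : ℂ → ℂ := fun w => ∫ u in Ioo (0:ℝ) 1, ((deriv g u : ℝ) : ℂ) * (u : ℂ) ^ w with hGt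
  set F₁ : ℂ → ℂ := fun w => w * P w + h₀ with hF₁
  set F₂ : ℂ → ℂ := fun w => -(riemannZeta w * Gt w) with hF₂
  set S : Set ℂ := {w : ℂ | -(1 / 2 : ℝ) < w.re} ∩ {w : ℂ | w.re < 1} with hS
  have hSopen : IsOpen S :=
    (isOpen_lt continuous_const Complex.continuous_re).inter
      (isOpen_lt Complex.continuous_re continuous_const)
  have hSconv : Convex ℝ S := (convex_halfSpace_re_gt _).inter (convex_halfSpace_re_lt _)
  -- Step 1: agreement on `0 < Re w < 1`
  have hagree : ∀ w : ℂ, 0 < w.re → w.re < 1 → F₁ w = F₂ w := by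
    intro w hw0 hw1
    have hw1' : w ≠ 1 := fun h => by rw [h, Complex.one_re] at hw1; exact lt_irrefl _ hw1
    have hw0' : w ≠ 0 := fun h => by rw [h, Complex.zero_re] at hw0; exact lt_irrefl _ hw0
    obtain ⟨_, hM⟩ := mellin_latticeProfile_eq hg hw0 hw1'
    obtain ⟨_, hPl⟩ := mellin_latticeProfile_eq_profileDev_add hg hw0 hw1'
    have hI := integral_mul_cpow_eq_of_admissible hg hw0
    have hPw : P w = mellin (fun y => ((latticeProfile g y : ℝ) : ℂ)) w - h₀ / w := by
      rw [hP, hPl]; ring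
    simp only [hF₁, hF₂, hGt]
    rw [hPw, hM, hI]
    field_simp
    ring
  -- Step 2: analyticity on `S`
  have hF₁an : AnalyticOnNhd ℂ F₁ S := by
    refine DifferentiableOn.analyticOnNhd (fun w hw => ?_) hSopen
    have hPd : DifferentiableAt ℂ P w :=
      differentiableAt_mellin_strip hΨmeas hΨσ₁ hΨσ₂ (by exact hw.1)
        (by have h2 : w.re < 1 := hw.2; linarith)
    exact ((differentiableAt_id.mul hPd).add_const h₀).differentiableWithinAt
  have hF₂an : AnalyticOnNhd ℂ F₂ S := by
    refine DifferentiableOn.analyticOnNhd (fun w hw => ?_) hSopen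
    have hw1 : w ≠ 1 := fun h => by
      have h2 := hw.2
      rw [h] at h2
      simp at h2
    have hre : -1 < w.re := by have := hw.1; simp at this; linarith
    exact ((differentiableAt_riemannZeta hw1).mul
      (differentiableAt_generatorTransform hg.1 hre)).neg.differentiableWithinAt
  have hEqOn : EqOn F₁ F₂ S := by
    have hz₀ : ((1 / 2 : ℝ) : ℂ) ∈ S := by
      simp only [hS, mem_inter_iff, mem_setOf_eq, Complex.ofReal_re]; norm_num
    refine hF₁an.eqOn_of_preconnected_of_eventuallyEq hF₂an hSconv.isPreconnected hz₀ ?_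
    have hO : IsOpen ({w : ℂ | (0:ℝ) < w.re} ∩ {w : ℂ | w.re < 1}) :=
      (isOpen_lt continuous_const Complex.continuous_re).inter
        (isOpen_lt Complex.continuous_re continuous_const)
    have hmem : ((1 / 2 : ℝ) : ℂ) ∈ {w : ℂ | (0:ℝ) < w.re} ∩ {w : ℂ | w.re < 1} := by
      simp only [mem_inter_iff, mem_setOf_eq, Complex.ofReal_re]; norm_num
    exact Filter.eventuallyEq_of_mem (hO.mem_nhds hmem) fun w hw => hagree w hw.1 hw.2
  -- Step 2': continuity at the boundary point `w₀`
  have hSsub : S ⊆ {s : ℂ | (-(1 / 2) : ℝ) ≤ s.re ∧ s.re ≤ 2} := fun w hw =>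
    ⟨le_of_lt hw.1, by have := hw.2; simp at this; linarith⟩
  have hcontP : ContinuousWithinAt P S w₀ :=
    ((continuousOn_mellin_strip hΨmeas hΨσ₁ hΨσ₂) w₀
      ⟨by rw [hw₀re], by rw [hw₀re]; norm_num⟩).mono hSsub
  have hcontF₁ : ContinuousWithinAt F₁ S w₀ :=
    (continuousWithinAt_id.mul hcontP).add continuousWithinAt_const
  have hcontF₂ : ContinuousWithinAt F₂ S w₀ := by
    have hw1 : w₀ ≠ 1 := fun h => by
      have := congrArg Complex.re h
      rw [hw₀re, Complex.one_re] at this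
      norm_num at this
    exact ((differentiableAt_riemannZeta hw1).mul (differentiableAt_generatorTransform hg.1
      (by rw [hw₀re]; norm_num))).neg.continuousAt.continuousWithinAt
  -- `w₀` lies in the closure of `S`
  have hneBot : (𝓝[S] w₀).NeBot := by
    apply mem_closure_iff_nhdsWithin_neBot.mp
    rw [mem_closure_iff_seq_limit]
    refine ⟨fun n : ℕ => w₀ + (((1 : ℝ) / ((n : ℝ) + 1) : ℝ) : ℂ), fun n => ?_, ?_⟩
    · have hn : (0:ℝ) < 1 / ((n : ℝ) + 1) := by positivity
      have hn' : 1 / ((n : ℝ) + 1) ≤ 1 := by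
        rw [div_le_one (by positivity)]; linarith [n.cast_nonneg (α := ℝ)]
      simp only [hS, mem_inter_iff, mem_setOf_eq, Complex.add_re, Complex.ofReal_re, hw₀re]
      constructor <;> linarith
    · have h1 : Tendsto (fun n : ℕ => (((1 : ℝ) / ((n : ℝ) + 1) : ℝ) : ℂ)) atTop (𝓝 0) := by
        rw [show (0 : ℂ) = ((0 : ℝ) : ℂ) by simp]
        exact (Complex.continuous_ofReal.tendsto 0).comp tendsto_one_div_add_atTop_nhds_zero_nat
      simpa using tendsto_const_nhds.add h1
  have hlim : F₁ w₀ = F₂ w₀ :=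
    tendsto_nhds_unique_of_eventuallyEq hcontF₁ hcontF₂
      (eventually_nhdsWithin_of_forall fun w hw => hEqOn hw)
  -- Step 3: conclude
  have key : w₀ * P w₀ + h₀ = -(riemannZeta w₀ * Gt w₀) := hlim
  rw [hHΨ]
  show P w₀ + h₀ / w₀ = riemannZeta w₀ / w₀ * -Gt w₀
  field_simp
  linear_combination key

end Summit.RiemannHypothesis.RiemannHypothesis.Theorems.SmoothSectorHardy

end
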